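import Literature.AnabelianGeometry.SemiGraphs.EmbeddingCriterion
import Literature.AnabelianGeometry.SemiGraphs.ImmersionSheets
import Literature.AnabelianGeometry.SemiGraphs.ZariskiMainTheorem

/-!
# Proof of [SemiAnbd] Theorem 1.2 (ii): Zariski's main theorem for semi-graphs, base change

Mochizuki, *Semi-graphs of anabelioids*, Publ. RIMS **42** (2006) 221–322, §1, Theorem 1.2 (ii),
author's manuscript pp. 15–16 [cite: MochizukiSemiAnbd2006, Thm. 1.2(ii) p.15]: for an immersion
`φ : G_A → G_B` of finite semi-graphs "there exists a finite graph-covering `G_B' → G_B` such that the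
restriction of the base-changed morphism `φ' : G_A' → G_B'` to each connected component of `G_A'` is
an embedding"; printed proof: "(ii) follows formally from (i) [by taking the finite graph-covering of
(ii) to be a Galois finite graph-covering of `G_B` that dominates the graph-covering of (i)]".

This file DISCHARGES the named fact `SemiGraph.zariskiMainTheorem_baseChange` of
`ZariskiMainTheorem.lean` (statement by abc-iut-L3-t1; "connected component" rendered as "connected
sub-semi-graph of the pull-back").  In place of a Galois closure we use the REGULAR permutation
covering directly: with the sheet data `(d, α, β, σ)` of `φ` (`exists_immersionSheets`), let `G_B'`
have fibre the finite group `P = Perm(Fin d)` with the branch `(b, g)` abutting to `(w, σ_b ∘ g)`.  On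
the pull-back `G_A ×_{G_B} G_B'` the *sheet invariant* `q` — `g⁻¹(α v)` at a vertex `(v, (w, g))`,
`g⁻¹(β e)` at an edge or at a branch of `e` — is constant along the barycentric subdivision (this is
the relation `σ_{φ(c)}(β e) = α v`), hence constant on every connected sub-semi-graph `H`; so two
vertices (edges) of `H` over the same vertex (edge) of `G_B'` have the same sheet `g`, hence the same
`α`- (`β`-) label, hence coincide, and the abutment condition of the embedding criterion
(`isEmbedding_of_injective`) follows from the same invariant together with the disjointness of the
`α`- and `β`-labels.  Proof-only (no definitions).
-/

namespace Literature.AnabelianGeometry.SemiGraphs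

namespace SemiGraph

open CategoryTheory

universe u

/-- DISCHARGE of `zariskiMainTheorem_baseChange` ([SemiAnbd] Theorem 1.2 (ii)): for an immersion
`φ : G_A → G_B` of finite semi-graphs there is a finite graph-covering `G_B' → G_B` such that the
base change `G_A ×_{G_B} G_B' → G_B'` restricted to any connected sub-semi-graph is an embedding.
[cite: MochizukiSemiAnbd2006, Thm. 1.2(ii) p.15] -/
theorem zariskiMainTheorem_baseChange_holds : zariskiMainTheorem_baseChange.{u} := by
  intro A B φ hA _ hφ
  classical
  obtain ⟨d, α, β, σ, hα, hβ, hαβ, hσv, hσn⟩ := exists_immersionSheets φ hA hφ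
  /- (1) the regular permutation covering `B'` of `B`: fibre the group `P = Perm (Fin d)`, the branch
  `(b, g)` abutting to `(w, σ_b * g)` -/
  let B' : SemiGraph.{u} :=
    { Vertex := B.Vertex × Equiv.Perm (Fin d)
      Edge := B.Edge × Equiv.Perm (Fin d)
      Branch := B.Branch × Equiv.Perm (Fin d)
      edgeOf := fun x => (B.edgeOf x.1, x.2)
      abuts := fun x => (B.abuts x.1).map fun w => (w, σ x.1 * x.2)
      two_branches := by
        rintro ⟨e, k⟩
        obtain ⟨b₁, b₂, hne, h₁, h₂, hall⟩ := B.two_branches e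
        refine ⟨(b₁, k), (b₂, k), fun h => hne (congrArg Prod.fst h), Prod.ext h₁ rfl,
          Prod.ext h₂ rfl, fun x hx => ?_⟩
        have hx1 : B.edgeOf x.1 = e := congrArg Prod.fst hx
        have hx2 : x.2 = k := congrArg Prod.snd hx
        rcases hall x.1 hx1 with h | h
        · exact Or.inl (Prod.ext h hx2)
        · exact Or.inr (Prod.ext h hx2) }
  have habuts : ∀ (x : B.Branch × Equiv.Perm (Fin d)) (y : B.Vertex × Equiv.Perm (Fin d)),
      B'.abuts x = some y ↔ B.abuts x.1 = some y.1 ∧ σ x.1 * x.2 = y.2 := by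
    intro x y
    change (B.abuts x.1).map _ = some y ↔ _
    cases B.abuts x.1 with
    | none => simp
    | some w =>
      simp only [Option.map_some, Option.some.injEq]
      constructor
      · rintro rfl
        exact ⟨rfl, rfl⟩
      · rintro ⟨h1, h2⟩
        exact Prod.ext h1 h2
  /- (2) the projection `π : B' → B` is a finite graph-covering -/
  let π : B' ⟶ B :=
    { vertexMap := Prod.fst
      edgeMap := Prod.fst
      branchMap := Prod.fst
      edgeOf_branchMap := fun _ => rfl
      branchMap_injOn := fun x y he h => Prod.ext h (by
        have h2 := congrArg Prod.snd he
        exact h2)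
      abuts_branchMap := fun x y h => ((habuts x y).1 h).1 }
  have hcov : IsFiniteGraphCovering π := by
    refine ⟨⟨?_, ?_⟩, fun w => ?_, fun e => ?_⟩
    · rintro ⟨e, k⟩
      change B.vertCard e = B'.vertCard (e, k)
      refine Nat.card_congr
        { toFun := fun b => ⟨(b.1, k), Prod.ext b.2.1 rfl, by
            change ((B.abuts b.1).map _).isSome = true
            rw [Option.isSome_map]
            exact b.2.2⟩
          invFun := fun y => ⟨y.1.1, congrArg Prod.fst y.2.1, by
            have h := y.2.2
            change ((B.abuts y.1.1).map _).isSome = true at h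
            rwa [Option.isSome_map] at h⟩
          left_inv := fun b => rfl
          right_inv := fun y => Subtype.ext (Prod.ext rfl (congrArg Prod.snd y.2.1).symm) }
    · rintro ⟨w, k⟩
      constructor
      · rintro ⟨x, hx⟩ ⟨x', hx'⟩ h
        have hb : x.1 = x'.1 := congrArg Subtype.val h
        obtain ⟨-, hk⟩ := (habuts x (w, k)).1 hx
        obtain ⟨-, hk'⟩ := (habuts x' (w, k)).1 hx'
        apply Subtype.ext
        refine Prod.ext hb (mul_left_cancel (a := σ x.1) ?_)
        rw [hk, ← hk', hb]
      · rintro ⟨b, hb⟩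
        exact ⟨⟨(b, (σ b)⁻¹ * k), (habuts _ (w, k)).2 ⟨hb, mul_inv_cancel_left _ _⟩⟩, rfl⟩
    · exact Finite.of_injective (fun x : {x : B.Vertex × Equiv.Perm (Fin d) // x.1 = w} => x.1.2)
        fun x y h => Subtype.ext (Prod.ext (x.2.trans y.2.symm) h)
    · exact Finite.of_injective (fun x : {x : B.Edge × Equiv.Perm (Fin d) // x.1 = e} => x.1.2)
        fun x y h => Subtype.ext (Prod.ext (x.2.trans y.2.symm) h)
  refine ⟨B', π, hcov, fun H hH => ?_⟩
  /- (3) the sheet invariant on the nodes of a sub-semi-graph `H` of the pull-back -/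
  let q : H.toSemiGraph.Node → Fin d := fun x =>
    match x with
    | Sum.inl x => x.1.1.2.2.symm (α x.1.1.1)
    | Sum.inr (Sum.inl y) => y.1.1.2.2.symm (β y.1.1.1)
    | Sum.inr (Sum.inr z) => z.1.1.2.2.symm (β (A.edgeOf z.1.1.1))
  -- the relation `σ_{φ c} (β e_c) = α v` makes `q` constant along the subdivision
  have hstep : ∀ a b : H.toSemiGraph.Node, H.toSemiGraph.NodeRel a b → q a = q b := by
    intro a b hr
    cases hr with
    | edge_branch z => rfl
    | branch_vertex z x h =>
      have hQ := H.ι.abuts_branchMap z x h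
      have hAv : A.abuts z.1.1.1 = some x.1.1.1 := (pullback.fst φ π).abuts_branchMap z.1 x.1 hQ
      have hBv : B'.abuts z.1.1.2 = some x.1.1.2 := (pullback.snd φ π).abuts_branchMap z.1 x.1 hQ
      obtain ⟨-, hg⟩ := (habuts _ _).1 hBv
      have hb : φ.branchMap z.1.1.1 = z.1.1.2.1 := z.1.2
      have key : σ z.1.1.2.1 (β (A.edgeOf z.1.1.1)) = α x.1.1.1 := by
        rw [← hb]
        exact hσv _ _ hAv
      change z.1.1.2.2.symm (β (A.edgeOf z.1.1.1)) = x.1.1.2.2.symm (α x.1.1.1)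
      rw [← hg, ← key]
      change _ = z.1.1.2.2.symm ((σ z.1.1.2.1).symm (σ z.1.1.2.1 (β (A.edgeOf z.1.1.1))))
      rw [Equiv.symm_apply_apply]
  have hq : ∀ a b : H.toSemiGraph.Node, q a = q b := by
    intro a b
    obtain ⟨w⟩ := hH.connected a b
    induction w with
    | nil => rfl
    | cons hadj _ ih =>
      refine Eq.trans ?_ ih
      rcases (SimpleGraph.fromRel_adj _ _ _).1 hadj with ⟨-, hr | hr⟩
      · exact hstep _ _ hr
      · exact (hstep _ _ hr).symm
  /- (4) the embedding criterion for `H → B'` -/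
  refine isEmbedding_of_injective _ (fun x y h => ?_) (fun x y h => ?_) (fun z x h => ?_)
  · -- vertices of `H` over the same vertex of `B'` coincide
    change x.1.1.2 = y.1.1.2 at h
    have hxy := hq (Sum.inl x) (Sum.inl y)
    change x.1.1.2.2.symm (α x.1.1.1) = y.1.1.2.2.symm (α y.1.1.1) at hxy
    rw [h] at hxy
    have hv : x.1.1.1 = y.1.1.1 := hα (y.1.1.2.2.symm.injective hxy)
    exact Subtype.ext (Subtype.ext (Prod.ext hv h))
  · -- edges of `H` over the same edge of `B'` coincide
    change x.1.1.2 = y.1.1.2 at h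
    have hxy := hq (Sum.inr (Sum.inl x)) (Sum.inr (Sum.inl y))
    change x.1.1.2.2.symm (β x.1.1.1) = y.1.1.2.2.symm (β y.1.1.1) at hxy
    rw [h] at hxy
    have he : x.1.1.1 = y.1.1.1 := hβ (y.1.1.2.2.symm.injective hxy)
    exact Subtype.ext (Subtype.ext (Prod.ext he h))
  · -- abutment is reflected
    change B'.abuts z.1.1.2 = some x.1.1.2 at h
    obtain ⟨hBw, hg⟩ := (habuts _ _).1 h
    have hb : φ.branchMap z.1.1.1 = z.1.1.2.1 := z.1.2
    have hzx := hq (Sum.inr (Sum.inr z)) (Sum.inl x)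
    change z.1.1.2.2.symm (β (A.edgeOf z.1.1.1)) = x.1.1.2.2.symm (α x.1.1.1) at hzx
    rw [← hg] at hzx
    change _ = z.1.1.2.2.symm ((σ z.1.1.2.1).symm (α x.1.1.1)) at hzx
    have key : σ z.1.1.2.1 (β (A.edgeOf z.1.1.1)) = α x.1.1.1 := by
      rw [(z.1.1.2.2.symm.injective hzx)]
      exact Equiv.apply_symm_apply _ _
    -- so `z`'s branch abuts in `A`, namely to the vertex of `x`
    cases hc : A.abuts z.1.1.1 with
    | none =>
      rw [← hb, hσn _ hc] at key
      exact absurd key.symm (hαβ _ _)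
    | some v =>
      have hv : v = x.1.1.1 := by
        rw [← hb, hσv _ v hc] at key
        exact hα key
      subst hv
      -- the pull-back branch abuts to the pull-back vertex of `x`
      have hQ : (pullback φ π).abuts z.1 = some x.1 := by
        have hvy : φ.vertexMap x.1.1.1 = π.vertexMap x.1.1.2 := x.1.2
        change ((A.abuts z.1.1.1).bind fun v => (B'.abuts z.1.1.2).bind fun v' =>
          if h : φ.vertexMap v = π.vertexMap v' then some ⟨(v, v'), h⟩ else none) = some x.1
        rw [hc, h]
        exact dif_pos hvy
      change ((pullback φ π).abuts z.1).pbind _ = _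
      simp only [hQ, Option.pbind_some]
      exact dif_pos x.2

end SemiGraph

end Literature.AnabelianGeometry.SemiGraphs
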